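import Literature.NumberTheory.EllipticCurves.TwoIsogenyTorsorImage
import Literature.NumberTheory.EllipticCurves.ShaIsogenyProofs
import HarnessLib

/-!
# `#ker Ш(ψ) = #(Ш(W) ∩ im Ξ_W)` for any isogeny `ψ` with kernel `{O, T}`

Stub `stub_kerCountOfKernel` (F2b) of the line `toric-node-vacuity-cassels` of the crux
`PencilSelmerDictionary` (stmt-Parity-11584, route IsogenyRedei).

For `W : y² = x³ + a₂x² + a₄x` elliptic in two-torsion normal form over a field `K` of characteristic `0`,
`T = T_W = (0,0)` (`geomTwoTorsionPoint`), `Ξ = twoIsogenyTorsorHom : K*/K*² → H¹(K, W)`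
(`[d] ↦ ξ_d = [σ ↦ χ_d(σ) T]`), and ANY isogeny `ψ : W → X` which is onto `K̄`-points with
`ker ψ = {O, T}` (e.g. the dual of the `2`-isogeny into `W`), we redo the tree file
`Literature/NumberTheory/EllipticCurves/TwoIsogenyTorsorImage.lean` (which treats `W`'s own explicit
`2`-isogeny `φ_W = twoIsogenyGeomHom`) with `φ_W` replaced by `ψ`; those proofs use only the equivariance,
the surjectivity and the kernel of `φ_W`:

* `galH1Map_twoIsogenyTorsorClass_of_ker` — `ψ_* ξ_d = 0` (`ψ T = O`);
* `exists_twoIsogenyTorsorClass_eq_of_galH1Map_eq_zero_of_ker` — a class killed by `ψ_*` is a `ξ_d`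
  (`ψ ∘ f = ∂(ψ P)`, so `g = f - ∂P : Γ_K → ker ψ = {O, T}` is a continuous homomorphism; the sign cocycle
  is `σ ↦ σβ/β` by Hilbert 90 for locally constant cocycles; `β² = d ∈ K`; `g = χ_d T`);
* `range_twoIsogenyTorsorHom_eq_ker_galH1Map_of_ker` — `im Ξ_W = ker ψ_*`;
* `stub_kerCountOfKernel` — over a number field, `#ker Ш(ψ) = #(Ш(W) ∩ im Ξ_W)`.

## References

* J. H. Silverman, *The Arithmetic of Elliptic Curves*, 2nd ed., GTM 106 (2009), Thm. X.4.2(a),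
  Prop. X.4.9. [SilvermanAEC2009]
* J.-P. Serre, *Local Fields*, Ch. X §1 Prop. 2 (Hilbert 90). [Serre1979]
-/

noncomputable section

open scoped Classical

universe u

namespace Summit.Parity.BatemanHorn.Theorems.PencilSelmerDictionary

open WeierstrassCurve
open Literature.NumberTheory.EllipticCurves Literature.NumberTheory.EllipticCurves.TwoIsogenyTorsor
open Literature.NumberTheory.GaloisRepresentations
open _root_.WeierstrassCurve.Affine (SqUnits sqClass sqClass_of_ne_zero)

/-- **`ψ_* ξ_d = 0`** for an isogeny `ψ : W → X` killing `T = (0,0)`: the torsor classes of `W` die in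
`H¹(K, X)`. [cite: SilvermanAEC2009, Thm. X.4.2(a)] -/
theorem galH1Map_twoIsogenyTorsorClass_of_ker {K : Type u} [Field K] [CharZero K]
    (W X : WeierstrassCurve K) [W.IsTwoTorsionNF] [W.IsElliptic] (ψ : W.Isogeny X)
    (hT : ψ W.geomTwoTorsionPoint = 0) {d : K} (hd : d ≠ 0) :
    galH1Map ψ.toAddMonoidHom ψ.equivariant (W.twoIsogenyTorsorClass hd) = 0 := by
  rw [twoIsogenyTorsorClass, galH1Map_oneCocycleClass, oneCocycleClass_eq_zero_iff]
  refine ⟨0, fun σ => ?_⟩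
  rw [contOneCocycles.push_apply, twoIsogenyTorsorCocycle_apply]
  change ψ (W.twoIsogenyTorsorFun d σ) = σ • (0 : X.geomPoints) - 0
  rw [smul_zero, sub_zero, twoIsogenyTorsorFun]
  split_ifs
  · exact map_zero _
  · exact hT

/-- **`H¹(K, W)[ψ_*] ⊆ im Ξ_W`** for an isogeny `ψ : W → X` onto `K̄`-points with kernel `{O, T}`
(surjectivity of `H¹(G, E[φ]) → WC(E/K)[φ]` in *AEC* X.4.2(a), made explicit): a class `c ∈ H¹(K, W)`
killed by `ψ_*` is a torsor class `ξ_d`. Proof: `ψ ∘ f = ∂Q` with `Q = ψ(P)` (`ψ` is onto `X(K̄)`), so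
`g = f - ∂P` takes values in `ker ψ = {O, T}` and is a continuous homomorphism `Γ_K → {O, T} ≅ {±1}`; by
Hilbert 90 (`exists_eq_smul_div_of_isLocallyConstant_cocycle`) the sign cocycle is `σ ↦ σβ/β`, then
`β² = d ∈ K` and `g = χ_d T`, i.e. `c = [g] = ξ_d`. [cite: SilvermanAEC2009, Thm. X.4.2(a)] -/
theorem exists_twoIsogenyTorsorClass_eq_of_galH1Map_eq_zero_of_ker {K : Type u} [Field K] [CharZero K]
    (W X : WeierstrassCurve K) [W.IsTwoTorsionNF] [W.IsElliptic] (ψ : W.Isogeny X)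
    (hsurj : Function.Surjective ψ) (hker : ∀ Q, ψ Q = 0 ↔ Q = 0 ∨ Q = W.geomTwoTorsionPoint)
    (c : W.galH1) (hc : galH1Map ψ.toAddMonoidHom ψ.equivariant c = 0) :
    ∃ (d : K) (hd : d ≠ 0), W.twoIsogenyTorsorClass hd = c := by
  obtain ⟨f, rfl⟩ := oneCocycleClass_surjective _ c
  rw [galH1Map_oneCocycleClass, oneCocycleClass_eq_zero_iff] at hc
  obtain ⟨Q, hQ⟩ := hc
  obtain ⟨P, rfl⟩ := hsurj Q
  have hQ' : ∀ σ : Field.absoluteGaloisGroup K, ψ (f.1 σ) = σ • ψ P - ψ P := fun σ => hQ σ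
  -- `g = f - ∂P` takes values in `{O, T}`
  set g := f - cobCocycle P (continuous_smul_geomPoints W P) with hg
  have hgval : ∀ σ : Field.absoluteGaloisGroup K, g.1 σ = f.1 σ - (σ • P - P) := fun σ => rfl
  have hgker : ∀ σ : Field.absoluteGaloisGroup K, g.1 σ = 0 ∨ g.1 σ = W.geomTwoTorsionPoint := by
    intro σ
    apply (hker _).mp
    rw [hgval, map_sub, map_sub, ψ.map_smul, hQ', sub_self]
  have hclass : oneCocycleClass _ g = oneCocycleClass _ f := by
    rw [hg, oneCocycleClass_sub, oneCocycleClass_cobCocycle, sub_zero]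
  have hT0 : W.geomTwoTorsionPoint ≠ 0 := geomTwoTorsionPoint_ne_zero W
  have hgmul : ∀ σ τ : Field.absoluteGaloisGroup K, g.1 (σ * τ) = g.1 σ + g.1 τ := by
    intro σ τ
    have h2 : g.1 (σ * τ) = g.1 σ + σ • g.1 τ := g.2 σ τ
    rw [h2]
    congr 1
    rcases hgker τ with h | h
    · rw [h, smul_zero]
    · rw [h, smul_geomTwoTorsionPoint]
  -- the sign cocycle
  set s : Field.absoluteGaloisGroup K → AlgebraicClosure K := fun σ => if g.1 σ = 0 then 1 else -1 with hs
  have hs0 : ∀ σ, s σ ≠ 0 := by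
    intro σ; simp only [hs]; split_ifs <;> norm_num
  have hslc : IsLocallyConstant s := by
    have hglc : IsLocallyConstant g.1 := (IsLocallyConstant.iff_continuous g.1).mpr g.1.continuous
    exact hglc.comp (fun x : W.geomPoints => if x = 0 then (1 : AlgebraicClosure K) else -1)
  have hsfix : ∀ σ τ : Field.absoluteGaloisGroup K, σ • s τ = s τ := by
    intro σ τ
    simp only [hs]
    split_ifs
    · exact smul_one σ
    · rw [smul_neg, smul_one]
  have hscoc : ∀ σ τ : Field.absoluteGaloisGroup K, s (σ * τ) = s σ * σ • s τ := by
    intro σ τ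
    rw [hsfix]
    simp only [hs, hgmul]
    rcases hgker σ with h1 | h1 <;> rcases hgker τ with h2 | h2
    · rw [if_pos (by rw [h1, h2, add_zero]), if_pos h1, if_pos h2, mul_one]
    · rw [if_neg (by rw [h1, h2, zero_add]; exact hT0), if_pos h1, if_neg (by rw [h2]; exact hT0), one_mul]
    · rw [if_neg (by rw [h1, h2, add_zero]; exact hT0), if_neg (by rw [h1]; exact hT0), if_pos h2, mul_one]
    · rw [if_pos (by rw [h1, h2, geomTwoTorsionPoint_add_self]), if_neg (by rw [h1]; exact hT0),
        if_neg (by rw [h2]; exact hT0)]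
      norm_num
  obtain ⟨β, hβ0, hβ⟩ :=
    absoluteGaloisGroup.exists_eq_smul_div_of_isLocallyConstant_cocycle K hslc hs0 hscoc
  have hσβ : ∀ σ : Field.absoluteGaloisGroup K, galAut K σ β = s σ * β := by
    intro σ
    change σ • β = s σ * β
    rw [hβ σ, div_mul_cancel₀ _ hβ0]
  have hs2 : ∀ σ, s σ ^ 2 = 1 := by
    intro σ; simp only [hs]; split_ifs <;> norm_num
  -- `β² = d ∈ K`
  have hβ2 : ∀ σ : Field.absoluteGaloisGroup K, galAut K σ (β ^ 2) = β ^ 2 := by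
    intro σ
    rw [map_pow, hσβ, mul_pow, hs2, one_mul]
  obtain ⟨d, hd⟩ := exists_algebraMap_eq_of_forall_galAut hβ2
  have hd0 : d ≠ 0 := by
    rintro rfl
    rw [map_zero, eq_comm] at hd
    exact pow_ne_zero 2 hβ0 hd
  have hroot : geomSqrt K d = β ∨ geomSqrt K d = -β := by
    rw [← mul_self_eq_mul_self_iff, geomSqrt_mul_self, hd, pow_two]
  -- `σ` fixes `√d` iff `g σ = 0`
  have hfix : ∀ σ : Field.absoluteGaloisGroup K, galAut K σ (geomSqrt K d) = geomSqrt K d ↔ g.1 σ = 0 := by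
    intro σ
    have key : galAut K σ β = β ↔ g.1 σ = 0 := by
      rw [hσβ σ]
      constructor
      · intro h
        by_contra hne
        have h1 : s σ = -1 := if_neg hne
        rw [h1] at h
        have : (2 : AlgebraicClosure K) * β = 0 := by linear_combination -h
        exact hβ0 (by simpa using this)
      · intro h
        rw [show s σ = 1 from if_pos h, one_mul]
    rcases hroot with h | h
    · rw [h, key]
    · rw [h, map_neg, neg_inj, key]
  refine ⟨d, hd0, ?_⟩
  rw [twoIsogenyTorsorClass, ← hclass]
  congr 1
  apply Subtype.ext
  ext σ
  rw [twoIsogenyTorsorCocycle_apply, twoIsogenyTorsorFun]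
  by_cases h : galAut K σ (geomSqrt K d) = geomSqrt K d
  · rw [if_pos h]; exact ((hfix σ).mp h).symm
  · rw [if_neg h]
    rcases hgker σ with h0 | hT
    · exact absurd ((hfix σ).mpr h0) h
    · exact hT.symm

/-- **`im Ξ_W = H¹(K, W)[ψ_*]`** for an isogeny `ψ : W → X` onto `K̄`-points with kernel `{O, T}` —
exactness of `K*/K*² →Ξ H¹(K, W) →ψ_* H¹(K, X)` at `H¹(K, W)` (Silverman, *AEC*, Thm. X.4.2(a): the Kummer
sequence of an isogeny `φ` gives `0 → E'(K)/φ(E(K)) → H¹(G, E[φ]) → WC(E/K)[φ] → 0`; here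
`E[ψ] = {O, T} ≅ μ₂` and `H¹(G, μ₂) = K*/K*²`, Prop. X.4.9).
[cite: SilvermanAEC2009, Thm. X.4.2(a) and Prop. X.4.9] -/
theorem range_twoIsogenyTorsorHom_eq_ker_galH1Map_of_ker {K : Type u} [Field K] [CharZero K]
    (W X : WeierstrassCurve K) [W.IsTwoTorsionNF] [W.IsElliptic] (ψ : W.Isogeny X)
    (hsurj : Function.Surjective ψ) (hker : ∀ Q, ψ Q = 0 ↔ Q = 0 ∨ Q = W.geomTwoTorsionPoint) :
    AddMonoidHom.range (G := Additive (SqUnits K)) W.twoIsogenyTorsorHom =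
      (galH1Map ψ.toAddMonoidHom ψ.equivariant).ker := by
  ext c
  constructor
  · rintro ⟨x, rfl⟩
    obtain ⟨u, hu⟩ := QuotientGroup.mk_surjective (Additive.toMul x)
    have hx : x = Additive.ofMul (sqClass (u : K)) := by
      rw [sqClass_of_ne_zero u.ne_zero, Units.mk0_val, hu]; rfl
    rw [hx, AddMonoidHom.mem_ker, twoIsogenyTorsorHom_sqClass W u.ne_zero]
    exact galH1Map_twoIsogenyTorsorClass_of_ker W X ψ ((hker _).mpr (Or.inr rfl)) u.ne_zero
  · intro hc
    obtain ⟨d, hd, h⟩ :=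
      exists_twoIsogenyTorsorClass_eq_of_galH1Map_eq_zero_of_ker W X ψ hsurj hker c hc
    exact ⟨Additive.ofMul (sqClass d), by rw [twoIsogenyTorsorHom_sqClass W hd, h]⟩

/-- **Stub F2b — `#ker Ш(ψ) = #(Ш(W) ∩ im Ξ_W)` for ANY isogeny with kernel `{O, T}`.** For `W` in
two-torsion normal form (elliptic) over a number field and an isogeny `ψ : W → X` which is onto
`K̄`-points with `ker ψ = {O, T_W}` — e.g. the dual of the `2`-isogeny INTO `W` — the kernel of
`Ш(ψ) : Ш(W) → Ш(X)` (`shaMap`, with the local points maps of `ψ`) is counted by the torsor classes of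
`W`'s own `2`-isogeny: `#ker Ш(ψ) = #(Ш(W) ∩ im Ξ_W)`, since `im Ξ_W = ker ψ_*`
(`range_twoIsogenyTorsorHom_eq_ker_galH1Map_of_ker`). Silverman, *AEC*, Thm. X.4.2(a), Prop. X.4.9.
[cite: SilvermanAEC2009, Thm. X.4.2(a)] -/
theorem stub_kerCountOfKernel {K : Type u} [Field K] [NumberField K] (W X : WeierstrassCurve K)
    [W.IsTwoTorsionNF] [W.IsElliptic] [X.IsElliptic] (ψ : W.Isogeny X)
    (hsurj : Function.Surjective ψ) (hker : ∀ Q, ψ Q = 0 ↔ Q = 0 ∨ Q = W.geomTwoTorsionPoint) :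
    Nat.card (shaMap ψ.toAddMonoidHom ψ.equivariant ψ.hasLocalPointsMaps_toAddMonoidHom).ker =
      Nat.card ↥(W.sha ⊓
        AddMonoidHom.range (G := Additive (WeierstrassCurve.Affine.SqUnits K)) W.twoIsogenyTorsorHom) := by
  have hmem : ∀ c : W.sha,
      c ∈ (shaMap ψ.toAddMonoidHom ψ.equivariant ψ.hasLocalPointsMaps_toAddMonoidHom).ker ↔
        (c : W.galH1) ∈ AddMonoidHom.range (G := Additive (SqUnits K)) W.twoIsogenyTorsorHom := by
    intro c
    rw [range_twoIsogenyTorsorHom_eq_ker_galH1Map_of_ker W X ψ hsurj hker, AddMonoidHom.mem_ker,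
      AddMonoidHom.mem_ker,
      ← coe_shaMap_apply ψ.toAddMonoidHom ψ.equivariant ψ.hasLocalPointsMaps_toAddMonoidHom c]
    exact ⟨fun h => by rw [h]; rfl, fun h => Subtype.ext h⟩
  symm
  refine Nat.card_eq_of_bijective (fun x => ⟨⟨x.1, x.2.1⟩, (hmem _).mpr x.2.2⟩) ⟨?_, ?_⟩
  · intro x y h
    exact Subtype.ext (congrArg
      (fun z : (shaMap ψ.toAddMonoidHom ψ.equivariant ψ.hasLocalPointsMaps_toAddMonoidHom).ker =>
        ((z : W.sha) : W.galH1)) h)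
  · rintro ⟨c, hc⟩
    exact ⟨⟨(c : W.galH1), c.2, (hmem c).mp hc⟩, rfl⟩

end Summit.Parity.BatemanHorn.Theorems.PencilSelmerDictionary
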